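import Literature.Analysis.PDE.EllipticSmoothBootstrapStep
import Literature.Analysis.PDE.EllipticSmoothBootstrapData
import Literature.Analysis.PDE.SchauderInteriorBall
import HarnessLib

/-!
# The Gilbarg–Trudinger 17.16 bootstrap: uniform higher-order bounds from uniform `C^{2,α}` bounds

The a-priori half of Gilbarg–Trudinger (2001), Lemma 17.16, for families: let
`G(y, θ, J)` be a smooth function of a point `y ∈ O ⊆ E`, a parameter `θ ∈ P` and a coordinate
`2`-jet `J ∈ CJet ι 2` (`Literature/Analysis/Calculus/CoordinateJets.lean`), and let
`u_k ∈ C^∞(O)` solve the fully nonlinear equations `G(y, θ_k, cjet₂ u_k(y)) = 0` on a ball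
`B(x₀, R)` with `B̄(x₀, R) ⊆ O`, with bounded parameters, UNIFORM `C^{2,α}` bounds on `B(x₀, R)`
and UNIFORM ellipticity of the top-order symbol `∂_{J₂}G` along the solutions.  Then all
derivatives are uniformly bounded on `B(x₀, R/2)`:
`uniform_iteratedFDeriv_bounds_of_holder_two`.

Proof (the coordinate-jet hierarchy).  Level `n` of the induction asserts
uniform bounds of `Dʲu_k`, `j ≤ n + 2`, and a uniform Hölder bound of `D^{n+2}u_k` on the ball of
radius `ρ_n = R/2 + R/2^{n+1}`.  For the step (`uniform_bounds_bootstrap_step`) differentiate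
the equation `n + 1` times along basis directions (`iterTD`,
`Literature/Analysis/PDE/EllipticSmoothBootstrapTD.lean`); the unknowns
`v = D^{n+1}u_k(·)(e_{M'})`, `M' : Fin (n+1) → ι`, solve linear equations
`∑ ã^{ab} D²v(e_a, e_b) = f` (`Literature/Analysis/PDE/EllipticSmoothBootstrapStep.lean`) whose
coefficients are the symmetrised top-order symbol of `G` along the `2`-jets — the same at every
level, uniformly elliptic, bounded and Hölder (`exists_symCoef_data`) — and whose right-hand sides
are smooth functions of the `(n+2)`-jets, hence uniformly bounded and Hölder by the level-`n`
bounds (`Literature/Analysis/PDE/EllipticSmoothBootstrapData.lean`).  The interior Schauder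
estimate on concentric balls (`Literature.Analysis.PDE.exists_schauder_interior_ball`,
Gilbarg–Trudinger Cor. 6.3) bounds `D²v` and its Hölder seminorm on the next ball; these are all
the components of `D^{n+3}u_k` in the basis, whence level `n + 1`
(`Literature/Analysis/Calculus/MultilinearComponentBounds.lean`).

Everything is fully proved; no named facts.  Not here: the Evans–Krylov `C^{2,α}` estimate
(Gilbarg–Trudinger Thm. 17.14) producing the hypotheses, and the geometric application to the
Gursky–Viaclovsky continuity method.

## References

* D. Gilbarg, N. S. Trudinger, *Elliptic Partial Differential Equations of Second Order*,
  Classics in Mathematics, Springer 2001, Lemma 17.16, Cor. 6.3. [GilbargTrudinger2001]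
-/

noncomputable section

open scoped ContDiff Topology NNReal
open Set Function Metric
open Literature.Analysis.Calculus Literature.Analysis.FunctionSpaces

namespace Literature.Analysis.PDE

variable {ι : Type*} [Fintype ι] [DecidableEq ι] {E : Type} [NormedAddCommGroup E]
  [InnerProductSpace ℝ E] [FiniteDimensional ℝ E] [MeasurableSpace E] [BorelSpace E] [Nontrivial E]
  {P : Type} [NormedAddCommGroup P] [NormedSpace ℝ P] [FiniteDimensional ℝ P]

omit [MeasurableSpace E] [BorelSpace E] [Nontrivial E] in
/-- **Uniform Schauder data of the coefficients.** Along a family of solutions with bounded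
parameters, uniform `C^{2,α}` bounds and uniform ellipticity on `B(x₀, R)`, the symmetrised
coefficients `ã^{ab}_k(z) = symCoef G a b (z, θ_k, cjet₂ u_k(z))` are uniformly bounded, uniformly
`α`-Hölder and uniformly elliptic on `B(x₀, R)`. [folklore] -/
theorem exists_symCoef_data (bE : OrthonormalBasis ι ℝ E) {G : E × P × CJet ι 2 → ℝ} {O : Set E}
    (hO : IsOpen O) (hG : ContDiffOn ℝ ∞ G {x | x.1 ∈ O}) {x₀ : E} {R : ℝ}
    (hRO : closedBall x₀ R ⊆ O) {α : ℝ≥0} (hα1 : α ≤ 1) {l : ℝ} {T B : ℝ} {θ : ℕ → P}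
    (hθ : ∀ k, ‖θ k‖ ≤ T) {u : ℕ → E → ℝ} (hu : ∀ k, ContDiffOn ℝ ∞ (u k) O)
    (hell : ∀ k, ∀ y ∈ ball x₀ R, ∀ η : E →L[ℝ] ℝ,
      l * ‖η‖ ^ 2 ≤ fderiv ℝ G (y, θ k, cjetOf bE 2 (u k) y)
        ((0 : E), (0 : P), Pi.single (Fin.last 2)
          (fun I : Fin 2 → ι => η (bE (I 0)) * η (bE (I 1)))))
    (hbd : ∀ k, ∀ y ∈ ball x₀ R, ∀ j ≤ 2, ‖iteratedFDeriv ℝ j (u k) y‖ ≤ B)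
    (hho : ∀ k, HolderOnWith B.toNNReal α (iteratedFDeriv ℝ 2 (u k)) (ball x₀ R)) :
    ∃ Ka : ℝ≥0, ∀ k,
      (∀ a b, ∀ z ∈ ball x₀ R, ‖symCoef G a b (z, θ k, cjetOf bE 2 (u k) z)‖ ≤ Ka) ∧
      (∀ a b, HolderOnWith Ka α (fun z => symCoef G a b (z, θ k, cjetOf bE 2 (u k) z))
        (ball x₀ R)) ∧
      (∀ z ∈ ball x₀ R, ∀ ξ : ι → ℝ, l * ∑ a, ξ a ^ 2 ≤
        ∑ a, ∑ b, symCoef G a b (z, θ k, cjetOf bE 2 (u k) z) * ξ a * ξ b) ∧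
      (∀ z ∈ ball x₀ R, ∀ ξ : ι → ℝ,
        ∑ a, ∑ b, symCoef G a b (z, θ k, cjetOf bE 2 (u k) z) * ξ a * ξ b ≤
          Fintype.card ι * Ka * ∑ a, ξ a ^ 2) := by
  have h := fun a b => exists_bound_holder_comp_cjetOf bE (P := P) (m := 2) hO
    (contDiffOn_symCoef hO hG a b) hRO le_rfl hα1 T (le_max_right B 0) B.toNNReal
  choose Mf Hf hMH using h
  refine ⟨∑ a, ∑ b, ((Mf a b).toNNReal + Hf a b), fun k => ?_⟩
  have hbd' : ∀ z ∈ ball x₀ R, ∀ j ≤ 2, ‖iteratedFDeriv ℝ j (u k) z‖ ≤ max B 0 :=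
    fun z hz j hj => (hbd k z hz j hj).trans (le_max_left _ _)
  have hdata := fun a b => hMH a b (θ k) (u k) (hθ k) (hu k) hbd' (hho k)
  have hKa : ∀ a b, (Mf a b).toNNReal + Hf a b ≤ ∑ a', ∑ b', ((Mf a' b').toNNReal + Hf a' b') :=
    fun a b => le_sum_sum (f := fun a' b' => (Mf a' b').toNNReal + Hf a' b') a b
  have hbound : ∀ a b, ∀ z ∈ ball x₀ R, ‖symCoef G a b (z, θ k, cjetOf bE 2 (u k) z)‖ ≤
      ((∑ a', ∑ b', ((Mf a' b').toNNReal + Hf a' b') : ℝ≥0) : ℝ) := fun a b z hz =>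
    ((hdata a b).1 z hz).trans ((Real.le_coe_toNNReal _).trans
      (NNReal.coe_le_coe.2 (le_self_add.trans (hKa a b))))
  refine ⟨hbound, fun a b => (hdata a b).2.mono_const (le_add_self.trans (hKa a b)),
    fun z hz ξ => symCoef_lower bE G _ (fun η => ?_) ξ,
    fun z hz ξ => sum_sum_mul_mul_le (fun a b => hbound a b z hz) ξ⟩
  rw [topSym_apply]
  exact hell k z hz η

omit [DecidableEq ι] [FiniteDimensional ℝ E] [MeasurableSpace E] [BorelSpace E] [Nontrivial E] in
/-- `|A(e_a, e_b)| ≤ ‖A‖` for a bilinear form and unit basis vectors. [folklore] -/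
theorem norm_apply_basis_two_le (bE : OrthonormalBasis ι ℝ E) (A : E [×2]→L[ℝ] ℝ) (a b : ι) :
    ‖A ![bE a, bE b]‖ ≤ ‖A‖ := by
  refine (A.le_opNorm _).trans ?_
  rw [Fin.prod_univ_two]
  simp [bE.norm_eq_one]

/-- **The bootstrap step** (level `n` ⇒ level `n + 1`).  Given the uniform Schauder data of the
coefficients on `B(x₀, R)`, radii `0 < r' < r ≤ R` and uniform bounds
`‖Dʲu_k‖ ≤ B_n` (`j ≤ n + 2`), `[D^{n+2}u_k]_{α; B(x₀, r)} ≤ B_n`, there is `B'` with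
`‖Dʲu_k‖ ≤ B'` (`j ≤ n + 3`) and `[D^{n+3}u_k]_{α; B(x₀, r')} ≤ B'` for all `k`: apply the
interior Schauder estimate on `B(x₀, r') ⊂ B(x₀, r)` to every unknown
`v = D^{n+1}u_k(·)(e_{M'})` and reassemble `D^{n+3}u_k` from its components.
[cite: GilbargTrudinger2001, Lemma 17.16] -/
theorem uniform_bounds_bootstrap_step (bE : OrthonormalBasis ι ℝ E) {G : E × P × CJet ι 2 → ℝ}
    {O : Set E} (hO : IsOpen O) (hG : ContDiffOn ℝ ∞ G {x | x.1 ∈ O}) {x₀ : E} {R : ℝ}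
    (hRO : closedBall x₀ R ⊆ O) {α : ℝ≥0} (hα0 : 0 < α) (hα1 : α < 1) {l : ℝ} (hl : 0 < l)
    {T : ℝ} {θ : ℕ → P} (hθ : ∀ k, ‖θ k‖ ≤ T) {u : ℕ → E → ℝ}
    (hu : ∀ k, ContDiffOn ℝ ∞ (u k) O)
    (heq : ∀ k, ∀ y ∈ ball x₀ R, G (y, θ k, cjetOf bE 2 (u k) y) = 0) {Ka : ℝ≥0}
    (hKa : ∀ k,
      (∀ a b, ∀ z ∈ ball x₀ R, ‖symCoef G a b (z, θ k, cjetOf bE 2 (u k) z)‖ ≤ Ka) ∧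
      (∀ a b, HolderOnWith Ka α (fun z => symCoef G a b (z, θ k, cjetOf bE 2 (u k) z))
        (ball x₀ R)) ∧
      (∀ z ∈ ball x₀ R, ∀ ξ : ι → ℝ, l * ∑ a, ξ a ^ 2 ≤
        ∑ a, ∑ b, symCoef G a b (z, θ k, cjetOf bE 2 (u k) z) * ξ a * ξ b) ∧
      (∀ z ∈ ball x₀ R, ∀ ξ : ι → ℝ,
        ∑ a, ∑ b, symCoef G a b (z, θ k, cjetOf bE 2 (u k) z) * ξ a * ξ b ≤
          Fintype.card ι * Ka * ∑ a, ξ a ^ 2))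
    {n : ℕ} {r r' : ℝ} (hr' : 0 < r') (hr'r : r' < r) (hrR : r ≤ R) {Bn : ℝ} (hBn : 0 ≤ Bn)
    (hlev : ∀ k, (∀ y ∈ ball x₀ r, ∀ j ≤ n + 2, ‖iteratedFDeriv ℝ j (u k) y‖ ≤ Bn) ∧
      HolderOnWith Bn.toNNReal α (iteratedFDeriv ℝ (n + 2) (u k)) (ball x₀ r)) :
    ∃ B' : ℝ, 0 ≤ B' ∧ ∀ k, (∀ y ∈ ball x₀ r', ∀ j ≤ n + 3, ‖iteratedFDeriv ℝ j (u k) y‖ ≤ B') ∧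
      HolderOnWith B'.toNNReal α (iteratedFDeriv ℝ (n + 3) (u k)) (ball x₀ r') := by
  have hrR' : ball x₀ r ⊆ ball x₀ R := ball_subset_ball hrR
  have hbR : ball x₀ R ⊆ O := ball_subset_closedBall.trans hRO
  have hbr : ball x₀ r ⊆ O := hrR'.trans hbR
  have hr'r' : ball x₀ r' ⊆ ball x₀ r := ball_subset_ball hr'r.le
  -- the Schauder constant of this level
  obtain ⟨C, hC⟩ := exists_schauder_interior_ball bE hα0 hα1 hl (Fintype.card ι * Ka) Ka x₀
    hr' hr'r
  -- uniform data of the right-hand sides, for every `(M, i)`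
  have hrhs : ∀ Mi : (Fin n → ι) × ι, ∃ Mf : ℝ, ∃ Hf : ℝ≥0, ∀ k,
      (∀ z ∈ ball x₀ r, ‖rhsFun bE n Mi.1 Mi.2 G (z, θ k, cjetOf bE (n + 2) (u k) z)‖ ≤ Mf) ∧
      HolderOnWith Hf α (fun z => rhsFun bE n Mi.1 Mi.2 G (z, θ k, cjetOf bE (n + 2) (u k) z))
        (ball x₀ r) := by
    intro Mi
    obtain ⟨Mf, Hf, h⟩ := exists_bound_holder_comp_cjetOf bE hO
      (contDiffOn_rhsFun bE hO hG n Mi.1 Mi.2) hRO hrR hα1.le T hBn Bn.toNNReal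
    exact ⟨Mf, Hf, fun k => h (θ k) (u k) (hθ k) (hu k) (hlev k).1 (hlev k).2⟩
  choose Mf Hf hrhs using hrhs
  -- the Schauder data bound of the unknown indexed by `M'`, uniform in `k`
  set BS : (Fin (n + 1) → ι) → ℝ≥0 := fun M' =>
    max (max (Mf (Fin.init M', M' (Fin.last n))).toNNReal (Hf (Fin.init M', M' (Fin.last n))))
      Bn.toNNReal with hBS
  have key : ∀ k (M' : Fin (n + 1) → ι),
      (∀ x ∈ ball x₀ r', ‖iteratedFDeriv ℝ 2
        (fun z => iteratedFDeriv ℝ (n + 1) (u k) z (fun t => bE (M' t))) x‖ ≤ C * BS M') ∧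
      HolderOnWith (C * BS M') α (iteratedFDeriv ℝ 2
        (fun z => iteratedFDeriv ℝ (n + 1) (u k) z (fun t => bE (M' t)))) (ball x₀ r') := by
    intro k M'
    obtain ⟨hK1, hK2, hK3, hK4⟩ := hKa k
    obtain ⟨hv1, hv2, hv3, hv4⟩ := iteratedFDeriv_apply_const_bounds bE hO (hu k) hbr M'
      (fun z hz => (hlev k).1 z hz (n + 1) (by omega)) (fun z hz => (hlev k).1 z hz (n + 2) le_rfl)
      (hlev k).2
    obtain ⟨hf1, hf2⟩ := hrhs (Fin.init M', M' (Fin.last n)) k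
    have hle1 : ((Mf (Fin.init M', M' (Fin.last n))).toNNReal : ℝ≥0) ≤ BS M' :=
      (le_max_left _ _).trans (le_max_left _ _)
    have hle2 : Hf (Fin.init M', M' (Fin.last n)) ≤ BS M' :=
      (le_max_right _ _).trans (le_max_left _ _)
    have hle3 : Bn.toNNReal ≤ BS M' := le_max_right _ _
    have hle3' : Bn ≤ (BS M' : ℝ) := (Real.le_coe_toNNReal Bn).trans (NNReal.coe_le_coe.2 hle3)
    refine hC (fun a b z => symCoef G a b (z, θ k, cjetOf bE 2 (u k) z))
      (fun a b z => symCoef_comm G a b _) (fun z hz ξ => hK3 z (hrR' hz) ξ)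
      (fun z hz ξ => hK4 z (hrR' hz) ξ) (fun a b z hz => hK1 a b z (hrR' hz))
      (fun a b => (hK2 a b).mono hrR')
      (fun z => iteratedFDeriv ℝ (n + 1) (u k) z (fun t => bE (M' t)))
      (fun z => rhsFun bE n (Fin.init M') (M' (Fin.last n)) G (z, θ k, cjetOf bE (n + 2) (u k) z))
      (BS M') hv1 (fun z hz => ?_) (fun z hz => ?_) (hf2.mono_const hle2)
      (fun z hz => (hv2 z hz).trans hle3') (fun z hz => (hv3 z hz).trans hle3')
      (hv4.mono_const hle3)
    · have h := sum_symCoef_mul_iteratedFDeriv_two_eq_rhsFun bE hO hG hbR (hu k) (heq k) n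
        (Fin.init M') (M' (Fin.last n)) (hrR' hz)
      rw [Fin.snoc_init_self] at h
      exact h
    · exact (hf1 z hz).trans ((Real.le_coe_toNNReal _).trans (NNReal.coe_le_coe.2 hle1))
  -- the components of `D^{n+3}u_k` are second derivatives of the unknowns
  have hcomp : ∀ k, ∀ I : Fin (n + 3) → ι, ∀ x ∈ ball x₀ r',
      iteratedFDeriv ℝ (n + 3) (u k) x (fun t => bE (I t)) =
        iteratedFDeriv ℝ 2 (fun z => iteratedFDeriv ℝ (n + 1) (u k) z (fun t => bE (I t.succ.succ)))
          x ![bE (I 0), bE (I (Fin.succ 0))] := fun k I x hx =>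
    iteratedFDeriv_basis_eq_two bE
      (((hu k).contDiffAt (hO.mem_nhds (hbr (hr'r' hx)))).of_le (WithTop.coe_le_coe.2 le_top)) I
  have hBSle : ∀ M', C * BS M' ≤ C * ∑ M'', BS M'' := fun M' =>
    mul_le_mul_right (Finset.single_le_sum (fun _ _ => zero_le) (Finset.mem_univ M')) C
  have htop1 : ∀ k, ∀ x ∈ ball x₀ r', ‖iteratedFDeriv ℝ (n + 3) (u k) x‖ ≤
      (Fintype.card ι) ^ (n + 3) * ((C * ∑ M', BS M' : ℝ≥0) : ℝ) := fun k =>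
    norm_multilinear_le_of_components bE fun I x hx => by
      rw [hcomp k I x hx, ← Real.norm_eq_abs]
      exact (norm_apply_basis_two_le bE _ _ _).trans
        (((key k _).1 x hx).trans (NNReal.coe_le_coe.2 (hBSle _)))
  have htop2 : ∀ k, HolderOnWith ((Fintype.card ι) ^ (n + 3) * (C * ∑ M', BS M')) α
      (iteratedFDeriv ℝ (n + 3) (u k)) (ball x₀ r') := fun k =>
    holderOnWith_multilinear_of_components bE fun I =>
      holderOnWith_congr_on (fun x hx => (hcomp k I x hx).symm)
        (holderOnWith_of_norm_sub_le_norm_sub (f := iteratedFDeriv ℝ 2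
          (fun z => iteratedFDeriv ℝ (n + 1) (u k) z (fun t => bE (I t.succ.succ))))
          (fun x _ y _ => by
            rw [← sub_apply]
            exact norm_apply_basis_two_le bE _ _ _)
          ((key k _).2.mono_const (hBSle _)))
  -- the constant of level `n + 1`
  refine ⟨max Bn ((Fintype.card ι) ^ (n + 3) * ((C * ∑ M', BS M' : ℝ≥0) : ℝ)),
    le_max_of_le_left hBn, fun k => ⟨fun y hy j hj => ?_, (htop2 k).mono_const ?_⟩⟩
  · rcases hj.lt_or_eq with hlt | rfl
    · exact ((hlev k).1 y (hr'r' hy) j (by omega)).trans (le_max_left _ _)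
    · exact (htop1 k y hy).trans (le_max_right _ _)
  · refine NNReal.le_toNNReal_of_coe_le ?_
    push_cast
    exact le_max_right _ _

/-- **Uniform higher-order interior bounds from uniform `C^{2,α}` bounds** (Gilbarg–Trudinger
2001, Lemma 17.16, a-priori half, for families): let `G(y, θ, J)` be `C^∞` in
`(y, θ, J) ∈ O × P × CJet ι 2` (`O ⊆ E` open) and let `u_k ∈ C^∞(O)` solve
`G(y, θ_k, cjet₂ u_k(y)) = 0` on the ball `B(x₀, R)`, `B̄(x₀, R) ⊆ O`, with parameters
`‖θ_k‖ ≤ T`, uniform `C^{2,α}` bounds on `B(x₀, R)` and uniform ellipticity of the top-order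
symbol `η ↦ ∂_{J₂}G(y, θ_k, cjet₂ u_k(y))[η⊗η] ≥ λ‖η‖²`. Then for every `m` there is
`B'` with `‖Dᵐ u_k‖ ≤ B'` on `B(x₀, R/2)` for all `k` (radii `R/2 + R/2^{n+1}` decreasing to `R/2`)
(differentiate the equation along the basis directions — `TD` — and apply the interior Schauder
estimate to the components of the derivatives, inductively).
[cite: GilbargTrudinger2001, Lemma 17.16] -/
theorem uniform_iteratedFDeriv_bounds_of_holder_two (bE : OrthonormalBasis ι ℝ E)
    {G : E × P × CJet ι 2 → ℝ} {O : Set E} (hO : IsOpen O)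
    (hG : ContDiffOn ℝ ∞ G {x | x.1 ∈ O}) {x₀ : E} {R : ℝ} (hR : 0 < R)
    (hRO : closedBall x₀ R ⊆ O) {α : ℝ≥0} (hα0 : 0 < α) (hα1 : α < 1) {l : ℝ} (hl : 0 < l)
    {T B : ℝ} {θ : ℕ → P} (hθ : ∀ k, ‖θ k‖ ≤ T) {u : ℕ → E → ℝ}
    (hu : ∀ k, ContDiffOn ℝ ∞ (u k) O)
    (heq : ∀ k, ∀ y ∈ ball x₀ R, G (y, θ k, cjetOf bE 2 (u k) y) = 0)
    (hell : ∀ k, ∀ y ∈ ball x₀ R, ∀ η : E →L[ℝ] ℝ,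
      l * ‖η‖ ^ 2 ≤ fderiv ℝ G (y, θ k, cjetOf bE 2 (u k) y)
        ((0 : E), (0 : P), Pi.single (Fin.last 2)
          (fun I : Fin 2 → ι => η (bE (I 0)) * η (bE (I 1)))))
    (hbd : ∀ k, ∀ y ∈ ball x₀ R, ∀ j ≤ 2, ‖iteratedFDeriv ℝ j (u k) y‖ ≤ B)
    (hho : ∀ k, HolderOnWith B.toNNReal α (iteratedFDeriv ℝ 2 (u k)) (ball x₀ R)) :
    ∀ m : ℕ, ∃ B' : ℝ, ∀ k, ∀ y ∈ ball x₀ (R / 2), ‖iteratedFDeriv ℝ m (u k) y‖ ≤ B' := by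
  -- the radii `ρ n = R/2 + R/2^(n+1)`: `ρ 0 = R`, decreasing, all `≥ R/2`
  set ρ : ℕ → ℝ := fun n => R / 2 + R / 2 ^ (n + 1) with hρ
  have hρ0 : ρ 0 = R := by simp only [hρ]; ring
  have hρpos : ∀ n, 0 < ρ n := fun n => by simp only [hρ]; positivity
  have hρlt : ∀ n, ρ (n + 1) < ρ n := fun n => by
    have h : R / 2 ^ (n + 1 + 1) < R / 2 ^ (n + 1) :=
      div_lt_div_of_pos_left hR (by positivity) (pow_lt_pow_right₀ (by norm_num) (by omega))
    simp only [hρ]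
    linarith
  have hρle : ∀ n, ρ n ≤ R := fun n => by
    have h : R / 2 ^ (n + 1) ≤ R / 2 :=
      div_le_div_of_nonneg_left hR.le (by norm_num)
        (le_self_pow₀ (by norm_num : (1 : ℝ) ≤ 2) (by omega))
    simp only [hρ]
    linarith
  have hhalf : ∀ n, R / 2 ≤ ρ n := fun n => by
    simp only [hρ]
    exact le_add_of_nonneg_right (by positivity)
  -- the coefficients: uniform Schauder data on `B(x₀, R)`
  obtain ⟨Ka, hKa⟩ := exists_symCoef_data bE hO hG hRO hα1.le hθ hu hell hbd hho
  -- the induction on the level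
  have main : ∀ n, ∃ Bn : ℝ, 0 ≤ Bn ∧ ∀ k,
      (∀ y ∈ ball x₀ (ρ n), ∀ j ≤ n + 2, ‖iteratedFDeriv ℝ j (u k) y‖ ≤ Bn) ∧
      HolderOnWith Bn.toNNReal α (iteratedFDeriv ℝ (n + 2) (u k)) (ball x₀ (ρ n)) := by
    intro n
    induction n with
    | zero =>
        refine ⟨max B 0, le_max_right _ _, fun k => ⟨fun y hy j hj => ?_, ?_⟩⟩
        · rw [hρ0] at hy
          exact (hbd k y hy j hj).trans (le_max_left _ _)
        · rw [hρ0]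
          exact (hho k).mono_const (Real.toNNReal_le_toNNReal (le_max_left _ _))
    | succ n ih =>
        obtain ⟨Bn, hBn, hlev⟩ := ih
        exact uniform_bounds_bootstrap_step bE hO hG hRO hα0 hα1 hl hθ hu heq hKa (hρpos (n + 1))
          (hρlt n) (hρle n) hBn hlev
  intro m
  obtain ⟨Bm, -, hBm⟩ := main m
  exact ⟨Bm, fun k y hy => (hBm k).1 y (ball_subset_ball (hhalf m) hy) m (by omega)⟩

end Literature.Analysis.PDE
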